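import Summits.Ventures.PercRepro2.CaseOneResidualIff

/-!
# Moves from a closed anchor
(blind cell PercRepro2, p1 g22; `closedAt_of_moves` started at the five closed anchors)

A closed anchor (a mark, a marked star, a uwob gadget, a roots-only or a roots-and-`o` vertex —
`ClosedAnchor`) has the four forms for every weight vector (`closedAt_of_closedAnchor`), so
**every instance reachable from it by moves** — pendant steps, leaf attachments, parallel duplications,
series subdivisions, loops — **is closed** (`closedAt_of_moves_closedAnchor`,
`fourForms_of_moves_closedAnchor`). With `closedAt_of_residual`: what remains of the rung is the
residual class at vertices that are not reachable by moves from a closed anchor. Own code; standard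
axioms. -/

namespace Summit.Ventures.PercRepro2

namespace CaseOne

universe u

section MovesAnchors
variable {V : Type*} [Fintype V] [DecidableEq V] {R : Type*} [Field R] [LinearOrder R]
  [IsStrictOrderedRing R]
variable (o a₁ a₂ b : V)

/-- A closed anchor has the four forms for every weight vector. -/
theorem closedAt_of_closedAnchor (E : Type u) [Fintype E] [DecidableEq E] (ends : E → Sym2 V) (v : V)
    (h : ClosedAnchor o a₁ a₂ b E ends v) : ClosedAt R o a₁ a₂ b E ends v :=
  fun p hp => fourForms_of_closedAnchor o a₁ a₂ b E ends p hp v h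

/-- **Every instance reachable by moves from a closed anchor is closed.** -/
theorem closedAt_of_moves_closedAnchor {E' : Type u} [Fintype E'] [DecidableEq E'] {ends' : E' → Sym2 V}
    {v' : V} (h' : ClosedAnchor o a₁ a₂ b E' ends' v') {E : Type u} [Fintype E] [DecidableEq E]
    {ends : E → Sym2 V} {v : V} (h : Moves o a₁ a₂ b E' ends' v' E ends v) :
    ClosedAt R o a₁ a₂ b E ends v :=
  closedAt_of_moves h (closedAt_of_closedAnchor o a₁ a₂ b E' ends' v' h')

/-- The four forms for one weight vector on every instance reachable by moves from a closed anchor. -/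
theorem fourForms_of_moves_closedAnchor {E' : Type u} [Fintype E'] [DecidableEq E'] {ends' : E' → Sym2 V}
    {v' : V} (h' : ClosedAnchor o a₁ a₂ b E' ends' v') {E : Type u} [Fintype E] [DecidableEq E]
    {ends : E → Sym2 V} {v : V} (h : Moves o a₁ a₂ b E' ends' v' E ends v) (p : E → R)
    (hp : IsProbVec p) : FourForms p ends o a₁ a₂ v b :=
  closedAt_of_moves_closedAnchor o a₁ a₂ b h' h p hp

/-- A mark is closed in every graph: every instance reachable by moves from a mark is closed. -/
theorem closedAt_of_moves_mark {E' : Type u} [Fintype E'] [DecidableEq E'] {ends' : E' → Sym2 V}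
    {v' : V} (h' : MarkAnchor o a₁ a₂ b E' ends' v') {E : Type u} [Fintype E] [DecidableEq E]
    {ends : E → Sym2 V} {v : V} (h : Moves o a₁ a₂ b E' ends' v' E ends v) :
    ClosedAt R o a₁ a₂ b E ends v :=
  closedAt_of_moves_closedAnchor o a₁ a₂ b (Or.inl h') h

end MovesAnchors

end CaseOne

end Summit.Ventures.PercRepro2
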